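import Mathlib.Algebra.Order.BigOperators.Ring.Finset
import Literature.Computability.Complexity.HuangDegree
import HarnessLib

/-!
# Sensitivity, `λ(f) ≤ √(s₀(f) s₁(f)) ≤ s(f)`, and Huang's theorem `deg(f) ≤ s(f)²` assembled

* **Sensitivity** (Nisan 1991; Aaronson–Ben-David–Kothari–Rao–Tal, STOC 2021, §2.2: «The number
  of sensitive bits for `x` is called the sensitivity of `x`, denoted by `s_x(f)`. Clearly
  `bs_x(f) ≥ s_x(f)` … We define `s(f) = max_x s_x(f)`»): `sensitivityAt f x`, `sensitivity f`,
  with `sensitivityAt_le_blockSensitivityAt` and — every certificate of `x` contains every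
  sensitive position of `x` — `sensitivityAt_le_certificateComplexityAt` (so `s_x ≤ bs_x` and
  `s_x ≤ C_x` against `BlockSensitivity.lean`).
* **ABKRT Lemma 29** «For all (possibly partial) functions `f`, `λ(f) ≤ √(s₀(f) s₁(f))`», and
  step 2 of Huang's proof «`∀ f: λ(f) ≤ s(f)` … the simple fact that the spectral norm of an
  adjacency matrix is at most the maximum degree of any vertex in the graph» (ABKRT §3), in the
  Rayleigh-quotient form in which the tree handles `λ(f) = ‖A_f‖` (`HuangDegree.lean`,
  `QuantumComplexity/SpectralAdversary.lean`; no matrix norms): for every real vector `δ`,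
  `∑_x ∑_{i : f(x) ≠ f(x^i)} δ_x δ_{x^i} ≤ √(s₀ s₁) · ∑_x δ_x²` whenever `s_x(f) ≤ s₀` on
  `0`-inputs and `≤ s₁` on `1`-inputs (`lambdaSum_le_sqrt_mul_sum_sq`), hence `≤ s(f) · ∑ δ²`
  (`lambdaSum_le_sensitivity_mul_sum_sq`). ABKRT prove Lemma 29 by Hölder's inequality for induced
  norms, `‖B‖ ≤ √(‖B‖₁ ‖B‖_∞)`; here the same content is the edge-by-edge AM–GM
  `2 δ_x δ_{x^i} ≤ r² δ_x² + r⁻² δ_{x^i}²` with the scale `r` on `0`-inputs and `r⁻¹` on `1`-inputs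
  (`r² = √s₁/√s₀`), followed by the reindexing `x ↦ x^i` (`sum_flipBlock_singleton`).
* **Huang's Sensitivity Theorem assembled** (Huang, Ann. of Math. 190 (2019), Thm. 1.4 «For every
  boolean function `f`, `s(f) ≥ √(deg(f))`»; ABKRT §8.3 «for all total Boolean functions `f`,
  `deg(f) ≤ s₀(f) s₁(f)`», also Laplante–Naserasr–Sunny 2020): from the tree's spectral half
  `huang_degree_pointwise` (`√deg(f) · δ_x ≤ ∑_{i sensitive} δ_{x^i}` for a unit `δ ≥ 0`) and the
  bound above, `booleanDegree f ≤ s₀ · s₁` (`booleanDegree_le_mul_of_sensitivity_le`),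
  `booleanDegree f ≤ sensitivity f ^ 2` (`booleanDegree_le_sensitivity_sq`) and
  `√(deg f) ≤ s(f)` (`sqrt_booleanDegree_le_sensitivity`).

Not here: `bs(f) ≤ s(f)⁴` (Huang Thm. 1.5, through Nisan–Szegedy / Tal `bs ≤ deg²`, not in the
tree), `s(f) ≤ λ(f)²` (ABKRT Lemma 32) and the spectral norm itself. No named facts.

## References

* H. Huang, *Induced subgraphs of hypercubes and a proof of the Sensitivity Conjecture*, Ann. of
  Math. 190 (2019) 949–955, Thm. 1.1, Thm. 1.4 (arXiv:1907.00847, p. 2) [Huang2019].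
* S. Aaronson, S. Ben-David, R. Kothari, S. Rao, A. Tal, *Degree vs. approximate degree and
  quantum implications of Huang's sensitivity theorem*, STOC 2021 (arXiv:2010.12629), §2.2
  (sensitivity), §3 (`λ(f) ≤ s(f)`), §8.3 Lemma 29, Prop. 28 and the display `deg(f) ≤ s₀(f)s₁(f)`
  [AaronsonBenDavidKothariRaoTal2021].
* N. Nisan, *CREW PRAMs and decision trees*, SIAM J. Comput. 20 (1991) (sensitivity vs. block
  sensitivity) [Nisan1991].
-/

noncomputable section

namespace Literature.Computability.Complexity

open Finset

variable {N : ℕ}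

/-! ### Sensitivity -/

/-- The sensitivity `s_x(f)` of `f` at `x`: the number of positions `i` with `f(x^i) ≠ f(x)`
(«the number of sensitive bits for `x`»). [cite: AaronsonBenDavidKothariRaoTal2021, §2.2] -/
def sensitivityAt (f : (Fin N → Bool) → Bool) (x : Fin N → Bool) : ℕ :=
  (Finset.univ.filter fun i => f (flipBlock x {i}) ≠ f x).card

/-- The sensitivity `s(f) = max_x s_x(f)`. [cite: AaronsonBenDavidKothariRaoTal2021, §2.2] -/
def sensitivity (f : (Fin N → Bool) → Bool) : ℕ :=
  Finset.univ.sup (sensitivityAt f)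

/-- Unfolding `s_x(f)`. [cite: AaronsonBenDavidKothariRaoTal2021, §2.2] -/
theorem sensitivityAt_eq_card (f : (Fin N → Bool) → Bool) (x : Fin N → Bool) :
    sensitivityAt f x = (Finset.univ.filter fun i => f (flipBlock x {i}) ≠ f x).card := rfl

/-- `s_x(f) ≤ s(f)`. [cite: AaronsonBenDavidKothariRaoTal2021, §2.2] -/
theorem sensitivityAt_le (f : (Fin N → Bool) → Bool) (x : Fin N → Bool) :
    sensitivityAt f x ≤ sensitivity f :=
  Finset.le_sup (f := sensitivityAt f) (Finset.mem_univ x)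

/-- `s_x(f) ≤ N`. [cite: AaronsonBenDavidKothariRaoTal2021, §2.2] -/
theorem sensitivityAt_le_card (f : (Fin N → Bool) → Bool) (x : Fin N → Bool) :
    sensitivityAt f x ≤ N :=
  (Finset.card_le_univ _).trans (Fintype.card_fin N).le

/-- `s(f) ≤ N`. [cite: AaronsonBenDavidKothariRaoTal2021, §2.2] -/
theorem sensitivity_le_card (f : (Fin N → Bool) → Bool) : sensitivity f ≤ N :=
  Finset.sup_le fun x _ => sensitivityAt_le_card f x

/-- **`s_x(f) ≤ bs_x(f)`**: the sensitive positions, as singleton blocks, form a disjoint sensitive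
family («clearly `bs_x(f) ≥ s_x(f)`, since `s_x(f)` has the same definition as `bs_x(f)` except that
the size of the blocks is restricted to `1`»). [cite: AaronsonBenDavidKothariRaoTal2021, §2.2] -/
theorem sensitivityAt_le_blockSensitivityAt (f : (Fin N → Bool) → Bool) (x : Fin N → Bool) :
    sensitivityAt f x ≤ blockSensitivityAt f x := by
  classical
  set S := Finset.univ.filter fun i => f (flipBlock x {i}) ≠ f x with hS
  have hinj : Function.Injective fun i : Fin N => ({i} : Finset (Fin N)) :=
    fun i j h => Finset.singleton_injective h
  have hfam : IsSensitiveFamily f x (S.image fun i => ({i} : Finset (Fin N))) := by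
    refine ⟨fun B hB => ?_, fun B hB B' hB' hne => ?_⟩
    · obtain ⟨i, hi, rfl⟩ := Finset.mem_image.1 hB
      exact (Finset.mem_filter.1 hi).2
    · obtain ⟨i, -, rfl⟩ := Finset.mem_image.1 (Finset.mem_coe.1 hB)
      obtain ⟨j, -, rfl⟩ := Finset.mem_image.1 (Finset.mem_coe.1 hB')
      have hij : i ≠ j := fun h => hne (by rw [h])
      change Disjoint (id ({i} : Finset (Fin N))) (id {j})
      simpa only [id, Finset.disjoint_singleton] using hij
  calc sensitivityAt f x = (S.image fun i => ({i} : Finset (Fin N))).card := by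
        rw [Finset.card_image_of_injective _ hinj]; rfl
    _ ≤ blockSensitivityAt f x := hfam.card_le

/-- `s(f) ≤ bs(f)`. [cite: AaronsonBenDavidKothariRaoTal2021, §2.2] -/
theorem sensitivity_le_blockSensitivity (f : (Fin N → Bool) → Bool) :
    sensitivity f ≤ blockSensitivity f :=
  Finset.sup_le fun x _ =>
    (sensitivityAt_le_blockSensitivityAt f x).trans (blockSensitivityAt_le f x)

/-- **Every certificate contains every sensitive position**: if `S` certifies `x` and
`f(x^i) ≠ f(x)` then `i ∈ S` (otherwise `x^i` agrees with `x` on `S`).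
[cite: BealsEtAl2001, Def 5.1] -/
theorem filter_sensitive_subset_of_isCertificate {f : (Fin N → Bool) → Bool} {x : Fin N → Bool}
    {S : Finset (Fin N)} (h : IsCertificate f x S) :
    (Finset.univ.filter fun i => f (flipBlock x {i}) ≠ f x) ⊆ S := by
  intro i hi
  by_contra hiS
  have hagree : ∀ j ∈ S, flipBlock x {i} j = x j := fun j hj =>
    flipBlock_singleton_apply_of_ne x (fun hji => hiS (hji ▸ hj))
  exact (Finset.mem_filter.1 hi).2 (h _ hagree)

/-- **`s_x(f) ≤ C_x(f)`.** [cite: BealsEtAl2001, Def 5.1] -/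
theorem sensitivityAt_le_certificateComplexityAt (f : (Fin N → Bool) → Bool) (x : Fin N → Bool) :
    sensitivityAt f x ≤ certificateComplexityAt f x := by
  obtain ⟨S, hS, hcard⟩ := exists_certificate_card_eq f x
  rw [← hcard]
  exact Finset.card_le_card (filter_sensitive_subset_of_isCertificate hS)

/-- `s(f) ≤ C(f)`. [cite: BealsEtAl2001, Def 5.1] -/
theorem sensitivity_le_certificateComplexity (f : (Fin N → Bool) → Bool) :
    sensitivity f ≤ certificateComplexity f :=
  Finset.sup_le fun x _ =>
    (sensitivityAt_le_certificateComplexityAt f x).trans (certificateComplexityAt_le f x)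

/-! ### `λ(f) ≤ √(s₀(f) s₁(f))` in Rayleigh form -/

/-- **Scaled edge count** (the core of ABKRT Lemma 29): for every real `δ` and scales `σ` with
`σ_x σ_{x^i} = 1` on every sensitive edge,
`∑_x ∑_{i : f(x) ≠ f(x^i)} δ_x δ_{x^i} ≤ ∑_x s_x(f) σ_x² δ_x²`
(AM–GM `2uv ≤ u² + v²` on `(σ_x δ_x)(σ_{x^i} δ_{x^i})`, then the reindexing `x ↦ x^i` of the second
half). [cite: AaronsonBenDavidKothariRaoTal2021, Lemma 29 (proof)] -/
theorem lambdaSum_le_sum_sensitivityAt_mul (f : (Fin N → Bool) → Bool)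
    (δ : (Fin N → Bool) → ℝ) (σ : (Fin N → Bool) → ℝ)
    (hσ1 : ∀ x i, f (flipBlock x {i}) ≠ f x → σ x * σ (flipBlock x {i}) = 1) :
    ∑ x, ∑ i, (if f x = f (flipBlock x {i}) then (0 : ℝ) else δ x * δ (flipBlock x {i})) ≤
      ∑ x, (sensitivityAt f x : ℝ) * (σ x ^ 2 * δ x ^ 2) := by
  classical
  -- the per-edge AM–GM with the scales inserted
  set h : (Fin N → Bool) → Fin N → ℝ := fun x i =>
    if f x = f (flipBlock x {i}) then 0 else σ x ^ 2 * δ x ^ 2 with hh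
  have hedge : ∀ x i, (if f x = f (flipBlock x {i}) then (0 : ℝ) else δ x * δ (flipBlock x {i}))
      ≤ (h x i + h (flipBlock x {i}) i) / 2 := by
    intro x i
    by_cases hxi : f x = f (flipBlock x {i})
    · have h1 : h x i = 0 := by simp only [hh, if_pos hxi]
      have h2 : h (flipBlock x {i}) i = 0 := by
        simp only [hh, flipBlock_singleton_flipBlock_singleton, if_pos hxi.symm]
      rw [if_pos hxi, h1, h2]
      norm_num
    · have hs : f (flipBlock x {i}) ≠ f x := fun e => hxi e.symm
      have h1 : h x i = σ x ^ 2 * δ x ^ 2 := by simp only [hh, if_neg hxi]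
      have h2 : h (flipBlock x {i}) i = σ (flipBlock x {i}) ^ 2 * δ (flipBlock x {i}) ^ 2 := by
        simp only [hh, flipBlock_singleton_flipBlock_singleton, if_neg hs]
      rw [if_neg hxi, h1, h2]
      have e : δ x * δ (flipBlock x {i}) =
          (σ x * δ x) * (σ (flipBlock x {i}) * δ (flipBlock x {i})) := by
        calc δ x * δ (flipBlock x {i})
            = (σ x * σ (flipBlock x {i})) * (δ x * δ (flipBlock x {i})) := by
              rw [hσ1 x i hs, one_mul]
          _ = _ := by ring
      rw [e]
      nlinarith [sq_nonneg (σ x * δ x - σ (flipBlock x {i}) * δ (flipBlock x {i}))]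
  -- the second half reindexes to the first
  have hre : ∀ i : Fin N, ∑ x, h (flipBlock x {i}) i = ∑ x, h x i :=
    fun i => sum_flipBlock_singleton i (fun y => h y i)
  have hrow : ∀ x, ∑ i, h x i = (sensitivityAt f x : ℝ) * (σ x ^ 2 * δ x ^ 2) := by
    intro x
    rw [sensitivityAt_eq_card]
    have e : ∀ i, h x i = if f (flipBlock x {i}) ≠ f x then σ x ^ 2 * δ x ^ 2 else 0 := by
      intro i
      simp only [hh]
      by_cases hxi : f x = f (flipBlock x {i})
      · rw [if_pos hxi, if_neg (fun hne => hne hxi.symm)]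
      · rw [if_neg hxi, if_pos (fun e => hxi e.symm)]
    simp_rw [e]
    rw [← Finset.sum_filter, Finset.sum_const, nsmul_eq_mul]
  have hswap : ∑ x, ∑ i, h (flipBlock x {i}) i = ∑ x, ∑ i, h x i := by
    rw [Finset.sum_comm]
    conv_rhs => rw [Finset.sum_comm]
    exact Finset.sum_congr rfl fun i _ => hre i
  calc ∑ x, ∑ i, (if f x = f (flipBlock x {i}) then (0 : ℝ) else δ x * δ (flipBlock x {i}))
      ≤ ∑ x, ∑ i, (h x i + h (flipBlock x {i}) i) / 2 :=
        Finset.sum_le_sum fun x _ => Finset.sum_le_sum fun i _ => hedge x i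
    _ = ((∑ x, ∑ i, h x i) + ∑ x, ∑ i, h (flipBlock x {i}) i) / 2 := by
        rw [← Finset.sum_add_distrib, Finset.sum_div]
        refine Finset.sum_congr rfl fun x _ => ?_
        rw [← Finset.sum_add_distrib, Finset.sum_div]
    _ = ∑ x, ∑ i, h x i := by
        rw [hswap]
        ring
    _ = ∑ x, (sensitivityAt f x : ℝ) * (σ x ^ 2 * δ x ^ 2) :=
        Finset.sum_congr rfl fun x _ => hrow x

/-- **ABKRT Lemma 29, Rayleigh form: `λ(f) ≤ √(s₀(f) s₁(f))`.** If `s_x(f) ≤ s₀` for every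
`0`-input and `s_x(f) ≤ s₁` for every `1`-input, then for every real vector `δ`,
`∑_x ∑_{i : f(x) ≠ f(x^i)} δ_x δ_{x^i} ≤ √(s₀ s₁) · ∑_x δ_x²` («`λ(f) = ‖A_f‖ = ‖B‖ ≤
√(‖B‖₁ ‖B‖_∞) = √(s₀(f) s₁(f))`, where … the maximum row and column sum of `B` are precisely
`s₀(f)` and `s₁(f)`»). [cite: AaronsonBenDavidKothariRaoTal2021, Lemma 29] -/
theorem lambdaSum_le_sqrt_mul_sum_sq (f : (Fin N → Bool) → Bool) {s₀ s₁ : ℕ}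
    (h0 : ∀ x, f x = false → sensitivityAt f x ≤ s₀)
    (h1 : ∀ x, f x = true → sensitivityAt f x ≤ s₁) (δ : (Fin N → Bool) → ℝ) :
    ∑ x, ∑ i, (if f x = f (flipBlock x {i}) then (0 : ℝ) else δ x * δ (flipBlock x {i})) ≤
      Real.sqrt (s₀ * s₁) * ∑ x, δ x ^ 2 := by
  classical
  by_cases hs : s₀ = 0 ∨ s₁ = 0
  · -- no sensitive edge at all
    have hnone : ∀ x i, f x = f (flipBlock x {i}) := by
      intro x i
      by_contra hxi
      have hsx : 0 < sensitivityAt f x := by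
        rw [sensitivityAt_eq_card, Finset.card_pos]
        exact ⟨i, Finset.mem_filter.2 ⟨Finset.mem_univ i, fun e => hxi e.symm⟩⟩
      have hsy : 0 < sensitivityAt f (flipBlock x {i}) := by
        rw [sensitivityAt_eq_card, Finset.card_pos]
        refine ⟨i, Finset.mem_filter.2 ⟨Finset.mem_univ i, ?_⟩⟩
        rw [flipBlock_singleton_flipBlock_singleton]
        exact hxi
      rcases hs with h | h
      · cases hx : f x
        · exact absurd (h0 x hx) (by omega)
        · have hy : f (flipBlock x {i}) = false := by
            cases hy : f (flipBlock x {i})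
            · rfl
            · exact absurd (hx.trans hy.symm) hxi
          exact absurd (h0 _ hy) (by omega)
      · cases hx : f x
        · have hy : f (flipBlock x {i}) = true := by
            cases hy : f (flipBlock x {i})
            · exact absurd (hx.trans hy.symm) hxi
            · rfl
          exact absurd (h1 _ hy) (by omega)
        · exact absurd (h1 x hx) (by omega)
    have hzero : ∀ x i,
        (if f x = f (flipBlock x {i}) then (0 : ℝ) else δ x * δ (flipBlock x {i})) = 0 :=
      fun x i => if_pos (hnone x i)
    simp only [hzero, Finset.sum_const_zero]
    exact mul_nonneg (Real.sqrt_nonneg _) (Finset.sum_nonneg fun x _ => sq_nonneg _)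
  · push Not at hs
    obtain ⟨hs0, hs1⟩ := hs
    have hs0' : (0 : ℝ) < s₀ := by exact_mod_cast Nat.pos_of_ne_zero hs0
    have hs1' : (0 : ℝ) < s₁ := by exact_mod_cast Nat.pos_of_ne_zero hs1
    -- the scale `r`, `r² = √s₁ / √s₀`
    set r : ℝ := Real.sqrt (Real.sqrt s₁ / Real.sqrt s₀) with hr
    have hr0 : 0 < r :=
      Real.sqrt_pos.2 (div_pos (Real.sqrt_pos.2 hs1') (Real.sqrt_pos.2 hs0'))
    have hr2 : r ^ 2 = Real.sqrt s₁ / Real.sqrt s₀ :=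
      Real.sq_sqrt (div_nonneg (Real.sqrt_nonneg _) (Real.sqrt_nonneg _))
    have hsq : Real.sqrt ((s₀ : ℝ) * s₁) = Real.sqrt s₀ * Real.sqrt s₁ :=
      Real.sqrt_mul (Nat.cast_nonneg _) _
    have hside0 : (s₀ : ℝ) * r ^ 2 = Real.sqrt (s₀ * s₁) := by
      rw [hr2, hsq]
      calc (s₀ : ℝ) * (Real.sqrt s₁ / Real.sqrt s₀) = (s₀ / Real.sqrt s₀) * Real.sqrt s₁ := by ring
        _ = Real.sqrt s₀ * Real.sqrt s₁ := by rw [Real.div_sqrt]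
    have hside1 : (s₁ : ℝ) * r⁻¹ ^ 2 = Real.sqrt (s₀ * s₁) := by
      rw [inv_pow, hr2, inv_div, hsq]
      calc (s₁ : ℝ) * (Real.sqrt s₀ / Real.sqrt s₁) = Real.sqrt s₀ * (s₁ / Real.sqrt s₁) := by ring
        _ = Real.sqrt s₀ * Real.sqrt s₁ := by rw [Real.div_sqrt]
    set σ : (Fin N → Bool) → ℝ := fun x => if f x = false then r else r⁻¹ with hσdef
    have hσ1 : ∀ x i, f (flipBlock x {i}) ≠ f x → σ x * σ (flipBlock x {i}) = 1 := by
      intro x i hne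
      simp only [hσdef]
      cases hx : f x <;> cases hy : f (flipBlock x {i})
      · exact absurd (hy.trans hx.symm) hne
      · simp [hr0.ne']
      · simp [hr0.ne']
      · exact absurd (hy.trans hx.symm) hne
    have key := lambdaSum_le_sum_sensitivityAt_mul f δ σ hσ1
    have hrow : ∀ x, (sensitivityAt f x : ℝ) * (σ x ^ 2 * δ x ^ 2) ≤
        Real.sqrt (s₀ * s₁) * δ x ^ 2 := by
      intro x
      rw [← mul_assoc]
      refine mul_le_mul_of_nonneg_right ?_ (sq_nonneg _)
      simp only [hσdef]
      cases hx : f x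
      · rw [if_pos rfl, ← hside0]
        exact mul_le_mul_of_nonneg_right (by exact_mod_cast h0 x hx) (sq_nonneg _)
      · rw [if_neg (by decide), ← hside1]
        exact mul_le_mul_of_nonneg_right (by exact_mod_cast h1 x hx) (sq_nonneg _)
    calc _ ≤ ∑ x, (sensitivityAt f x : ℝ) * (σ x ^ 2 * δ x ^ 2) := key
      _ ≤ ∑ x, Real.sqrt (s₀ * s₁) * δ x ^ 2 := Finset.sum_le_sum fun x _ => hrow x
      _ = Real.sqrt (s₀ * s₁) * ∑ x, δ x ^ 2 := by rw [← Finset.mul_sum]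

/-- **Huang's step 2 / `λ(f) ≤ s(f)`** («the spectral norm of an adjacency matrix is at most the
maximum degree of any vertex in the graph, which equals `s(f)` in this case»): for every real
`δ`, `∑_x ∑_{i : f(x) ≠ f(x^i)} δ_x δ_{x^i} ≤ s(f) · ∑_x δ_x²`.
[cite: AaronsonBenDavidKothariRaoTal2021, §3] -/
theorem lambdaSum_le_sensitivity_mul_sum_sq (f : (Fin N → Bool) → Bool)
    (δ : (Fin N → Bool) → ℝ) :
    ∑ x, ∑ i, (if f x = f (flipBlock x {i}) then (0 : ℝ) else δ x * δ (flipBlock x {i})) ≤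
      (sensitivity f : ℝ) * ∑ x, δ x ^ 2 := by
  have h := lambdaSum_le_sqrt_mul_sum_sq f (s₀ := sensitivity f) (s₁ := sensitivity f)
    (fun x _ => sensitivityAt_le f x) (fun x _ => sensitivityAt_le f x) δ
  rwa [Real.sqrt_mul_self (Nat.cast_nonneg _)] at h

/-- **The printed two-sided form** with the maxima `s₀(f) = max_{f x = 0} s_x(f)` and
`s₁(f) = max_{f x = 1} s_x(f)` written as `Finset.sup`s (the tree keeps no separate names for
them): `∑_x ∑_{i : f(x) ≠ f(x^i)} δ_x δ_{x^i} ≤ √(s₀(f) s₁(f)) · ∑_x δ_x²`.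
[cite: AaronsonBenDavidKothariRaoTal2021, Lemma 29] -/
theorem lambdaSum_le_sqrt_zero_one_sensitivity (f : (Fin N → Bool) → Bool)
    (δ : (Fin N → Bool) → ℝ) :
    ∑ x, ∑ i, (if f x = f (flipBlock x {i}) then (0 : ℝ) else δ x * δ (flipBlock x {i})) ≤
      Real.sqrt (((Finset.univ.filter fun x => f x = false).sup (sensitivityAt f) : ℕ) *
          ((Finset.univ.filter fun x => f x = true).sup (sensitivityAt f) : ℕ)) *
        ∑ x, δ x ^ 2 := by
  classical
  refine lambdaSum_le_sqrt_mul_sum_sq f (fun x hx => ?_) (fun x hx => ?_) δ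
  · exact Finset.le_sup (f := sensitivityAt f) (by simpa using hx)
  · exact Finset.le_sup (f := sensitivityAt f) (by simpa using hx)

/-! ### Huang's Sensitivity Theorem -/

/-- **`deg(f) ≤ s₀ · s₁`** for any bounds `s₀`, `s₁` of the sensitivities of the `0`- and
`1`-inputs (ABKRT: «for all total Boolean functions `f`, `deg(f) ≤ s₀(f) s₁(f)`»; Huang's
Thm. 1.4 followed by Lemma 29): the tree's `huang_degree_pointwise` gives a unit `δ ≥ 0` with
`√deg(f) · δ_x ≤ ∑_{i : f(x) ≠ f(x^i)} δ_{x^i}`; summing against `δ_x` gives `√deg(f) ≤`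
the `λ`-sum `≤ √(s₀ s₁)`. [cite: AaronsonBenDavidKothariRaoTal2021, §8.3 (display after Lemma 30)]
[cite: Huang2019, Thm. 1.4] -/
theorem booleanDegree_le_mul_of_sensitivity_le (f : (Fin N → Bool) → Bool) {s₀ s₁ : ℕ}
    (h0 : ∀ x, f x = false → sensitivityAt f x ≤ s₀)
    (h1 : ∀ x, f x = true → sensitivityAt f x ≤ s₁) :
    booleanDegree f ≤ s₀ * s₁ := by
  obtain ⟨δ, hδ, hδ1, hpt⟩ := huang_degree_pointwise f
  -- `√deg = √deg · ∑ δ² ≤ ∑_x δ_x ∑_{i sens} δ_{x^i} ≤ √(s₀ s₁) · ∑ δ² = √(s₀ s₁)`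
  have hle : Real.sqrt (booleanDegree f) ≤ Real.sqrt (s₀ * s₁) := by
    calc Real.sqrt (booleanDegree f)
        = ∑ x, δ x * (Real.sqrt (booleanDegree f) * δ x) := by
          have h : ∑ x, δ x * (Real.sqrt (booleanDegree f) * δ x) =
              Real.sqrt (booleanDegree f) * ∑ x, δ x ^ 2 := by
            rw [Finset.mul_sum]; exact Finset.sum_congr rfl fun x _ => by ring
          rw [h, hδ1, mul_one]
      _ ≤ ∑ x, δ x * ∑ i, (if f x = f (flipBlock x {i}) then 0 else δ (flipBlock x {i})) :=
          Finset.sum_le_sum fun x _ => mul_le_mul_of_nonneg_left (hpt x) (hδ x)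
      _ = ∑ x, ∑ i, (if f x = f (flipBlock x {i}) then (0 : ℝ) else δ x * δ (flipBlock x {i})) := by
          refine Finset.sum_congr rfl fun x _ => ?_
          rw [Finset.mul_sum]
          refine Finset.sum_congr rfl fun i _ => ?_
          split_ifs <;> ring
      _ ≤ Real.sqrt (s₀ * s₁) * ∑ x, δ x ^ 2 := lambdaSum_le_sqrt_mul_sum_sq f h0 h1 δ
      _ = Real.sqrt (s₀ * s₁) := by rw [hδ1, mul_one]
  have h2 : ((booleanDegree f : ℕ) : ℝ) ≤ (s₀ * s₁ : ℕ) := by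
    have := (Real.sqrt_le_sqrt_iff (by positivity)).1 hle
    exact_mod_cast this
  exact_mod_cast h2

/-- **Huang's Sensitivity Theorem** (Ann. of Math. 2019, Thm. 1.4: «For every boolean function `f`,
`s(f) ≥ √deg(f)`», i.e. `deg(f) ≤ s(f)²`), assembled from the tree's spectral half
`huang_degree_pointwise` and `λ(f) ≤ s(f)`. [cite: Huang2019, Thm. 1.4] -/
theorem booleanDegree_le_sensitivity_sq (f : (Fin N → Bool) → Bool) :
    booleanDegree f ≤ sensitivity f ^ 2 := by
  rw [sq]
  exact booleanDegree_le_mul_of_sensitivity_le f (fun x _ => sensitivityAt_le f x)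
    (fun x _ => sensitivityAt_le f x)

/-- Huang's Thm. 1.4 in its printed shape `√deg(f) ≤ s(f)`. [cite: Huang2019, Thm. 1.4] -/
theorem sqrt_booleanDegree_le_sensitivity (f : (Fin N → Bool) → Bool) :
    Real.sqrt (booleanDegree f) ≤ sensitivity f := by
  rw [Real.sqrt_le_left (Nat.cast_nonneg _)]
  exact_mod_cast booleanDegree_le_sensitivity_sq f

end Literature.Computability.Complexity

end
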